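import Mathlib
import HarnessLib
import Summits.NavierStokesRegularity.NavierStokesRegularity.Theses.SymmetryModuliCount
import Literature.Analysis.FluidPDE.VectorCalculus
import Literature.Analysis.FluidPDE.LocalTypeI
import Literature.Analysis.FluidPDE.SuitableWeak
import Literature.Analysis.FluidPDE.SelfSimilar

/-!
# Sketch — crux-ideate stmt-NavierStokesRegularity-4054 (LinearLiouvilleSeven), ideator 2, round 1

First lemmas of the two idea cards of this seat, stated as `Prop`s over existing declarations
(no proofs at this stage; everything must elaborate):

* `idea-ancient-energy-ledger.md` — `QuadraticLedger`, `FinalTraceExists`, `EnergyTypeI` (K1),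
  `ABClassOfTimeShift` (K1 in Albritton–Barker form), `DiluteLiouville` (K2),
  `FiniteSimilarityEnergyLiouville` (anchor of K2), and the pure-logic transfer
  `typeIAncientLiouville_of_energyTypeI`.
* `idea-mild-gauge-tangent-space.md` — `IsTemperedMild` (the gauge-fixed tangent space),
  `GalileanExclusionMild` (first lemma), `TangentSpaceSplitting`, `JacobiMild8`, `LLmild8` (crux),
  `TimeSymmetricReduction`.

Conventions are those of the route file `Theses/SymmetryModuliCount.lean` (class `𝒜_C` verbatim).
-/

set_option linter.dupNamespace false

noncomputable section

namespace Summit.NavierStokesRegularity.NavierStokesRegularity.Cruxes.LinearLiouvilleSeven.Ideator2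

open scoped InnerProductSpace ENNReal
open MeasureTheory Literature.Analysis.FluidPDE

local notation "ℝ³" => EuclideanSpace ℝ (Fin 3)

/-- The class `𝒜_C` of the route, verbatim (smooth on `t<0`, div-free, KNSS-mild Oseen equation,
Type-I time decay). -/
def InClassA (C : ℝ) (u : ℝ → ℝ³ → ℝ³) : Prop :=
  ContDiffOn ℝ (⊤ : ℕ∞) (Function.uncurry u) (Set.Iio 0 ×ˢ Set.univ) ∧
  (∀ t < 0, VectorCalculus.IsDivFree (u t)) ∧
  (∀ s t : ℝ, s < t → t < 0 → ∀ x, u t x = heatFlow (u s) (t - s) x -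
      ∫ τ in Set.Ioo s t, ∫ y, oseenKernel (t - τ) (x - y) (u τ y) (u τ y)) ∧
  HasTypeITimeDecay C u

/-- Time shift by `h ≥ 0`: `u_h(t) = u(t - h)`; maps `𝒜_C` to itself and makes the element
bounded near `t = 0` (the eighth, semigroup, symmetry of the class). -/
def timeShift (h : ℝ) (u : ℝ → ℝ³ → ℝ³) : ℝ → ℝ³ → ℝ³ := fun t x => u (t - h) x

/-! ## Card `ancient-energy-ledger` -/

/-- FIRST LEMMA (the ledger, provable; size M–L): integrating the exact local energy identity of an
element of `𝒜_C` from `t = -∞` (where the local energy vanishes by the Type-I bound) gives, for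
every ball, centre and time, the QUADRATIC scale-invariant bound on the slice energy and on the
total backward dissipation, `E_R(t) + ∫_{-∞}^t ∫_{B_R} |∇u|² ≤ K R² / √(-t)`, with `K` depending
only on the Type-I constant `C` and the scale-invariant gradient constant `C₁` (KNSS-gauge input;
the BMO bound on the Oseen pressure `p = R_iR_j(u_iu_j)` is derived inside the proof). -/
def QuadraticLedger : Prop :=
  ∀ C C₁ : ℝ, ∃ K : ℝ, ∀ u : ℝ → ℝ³ → ℝ³, InClassA C u →
    (∀ t < 0, ∀ x, ‖fderiv ℝ (u t) x‖ ≤ C₁ / (-t)) →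
    ∀ t < 0, ∀ (x₀ : ℝ³) (R : ℝ), 0 < R →
      (∫ x in Metric.ball x₀ R, ‖u t x‖ ^ 2) ≤ K * R ^ 2 / Real.sqrt (-t) ∧
      (∫ τ in Set.Iio t, ∫ x in Metric.ball x₀ R, ‖fderiv ℝ (u τ) x‖ ^ 2) ≤ K * R ^ 2 / Real.sqrt (-t)

/-- CONSEQUENCE of the ledger (provable from `QuadraticLedger`, size M): every element of `𝒜_C`
has a FINAL TRACE `W = u(0⁻)` in the sense of distributions — for every test field the pairing
`t ↦ ∫ ⟪u(t,x), ψ(x)⟫ dx` converges as `t ↑ 0` (the nonlinear term is integrable up to `t = 0`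
because `∫_{B_R}|u(t)|² ≲ R²/√(-t)` is integrable at `0`). -/
def FinalTraceExists : Prop :=
  ∀ (C : ℝ) (u : ℝ → ℝ³ → ℝ³), InClassA C u →
    ∀ ψ : ℝ³ → ℝ³, ContDiff ℝ (⊤ : ℕ∞) ψ → HasCompactSupport ψ →
      ∃ ℓ : ℝ, Filter.Tendsto (fun t => ∫ x, ⟪u t x, ψ x⟫_ℝ) (nhdsWithin 0 (Set.Iio 0)) (nhds ℓ)

/-- CRUX K1 (`EnergyTypeI`, slice form): the logarithm in the ledger can be broken — the slice
energy and the backward dissipation of an element of `𝒜_C` grow LINEARLY in the radius, uniformly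
in time and centre (`∫_{B_R(x₀)}|u(t)|² ≤ Λ R`). This is the `p = ∞` case that Albritton–Barker
2019 (Rmk 3.2) leave open: it puts `𝒜_C` (after a time shift) inside their local Type-I class. -/
def EnergyTypeI : Prop :=
  ∀ C : ℝ, ∃ Λ : ℝ, ∀ u : ℝ → ℝ³ → ℝ³, InClassA C u →
    ∀ t < 0, ∀ (x₀ : ℝ³) (R : ℝ), 0 < R →
      (∫ x in Metric.ball x₀ R, ‖u t x‖ ^ 2) ≤ Λ * R ∧
      (∫ τ in Set.Ioo (t - R ^ 2) t, ∫ x in Metric.ball x₀ R, ‖fderiv ℝ (u τ) x‖ ^ 2) ≤ Λ * R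

/-- CRUX K1 in Albritton–Barker form (the class bridge included): every time shift `u_h`, `h > 0`,
of an element of `𝒜_C` is, with its Oseen pressure and its classical gradient, a suitable weak
solution on the slab `(-∞,0) × ℝ³` with FINITE Albritton–Barker quantity `𝐈(ℝ³ × ℝ₋)`, it is a
bounded ancient mild solution in the tree's duality sense, and its slices are measurable. -/
def ABClassOfTimeShift : Prop :=
  ∀ (C : ℝ) (u : ℝ → ℝ³ → ℝ³), InClassA C u → ∀ h : ℝ, 0 < h →
    ∃ (p : ℝ → ℝ³ → ℝ) (G : ℝ → ℝ³ → ℝ³ →L[ℝ] ℝ³),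
      (∀ t < 0, AEStronglyMeasurable (timeShift h u t) volume) ∧
      IsBoundedAncientMildSolution 1 (timeShift h u) ∧
      IsSuitableWeakSolutionOn (slab ℝ³ (Set.Iio 0) isOpen_Iio) 1 0 (timeShift h u) p ∧
      HasWeakSpatialGradientOn (slab ℝ³ (Set.Iio 0) isOpen_Iio) (timeShift h u) G ∧
      typeIBound (Set.Iio (0 : ℝ) ×ˢ (Set.univ : Set ℝ³)) (timeShift h u) p G < ⊤

/-- Route MarginalTypeI's crux `NoTypeIAncient` (stmt-NavierStokesRegularity-1749), verbatim: (L′)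
in the Albritton–Barker local Type-I class. -/
def NoTypeIAncientAB : Prop :=
  ¬ ∃ (u : ℝ → ℝ³ → ℝ³) (p : ℝ → ℝ³ → ℝ) (G : ℝ → ℝ³ → ℝ³ →L[ℝ] ℝ³),
    (∀ t < 0, AEStronglyMeasurable (u t) volume) ∧
    IsBoundedAncientMildSolution 1 u ∧
    IsSuitableWeakSolutionOn (slab ℝ³ (Set.Iio 0) isOpen_Iio) 1 0 u p ∧
    HasWeakSpatialGradientOn (slab ℝ³ (Set.Iio 0) isOpen_Iio) u G ∧
    ¬ (Function.uncurry u =ᵐ[volume.restrict (Set.Iio (0 : ℝ) ×ˢ (Set.univ : Set ℝ³))] 0) ∧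
    typeIBound (Set.Iio (0 : ℝ) ×ˢ (Set.univ : Set ℝ³)) u p G < ⊤

/-- Elementary support fact used by the transfer: a CONTINUOUS function on the open lower slab that
is a.e. zero there is zero there (continuity on an open set of positive measure everywhere). -/
def AEZeroContinuousIsZero : Prop :=
  ∀ v : ℝ → ℝ³ → ℝ³, ContinuousOn (Function.uncurry v) (Set.Iio 0 ×ˢ Set.univ) →
    Function.uncurry v =ᵐ[volume.restrict (Set.Iio (0 : ℝ) ×ˢ (Set.univ : Set ℝ³))] 0 →
    ∀ t < 0, ∀ x, v t x = 0

/-- TRANSFER of card 1 (pure logic, PROVED here): K1 in A–B form plus MarginalTypeI's crux 1749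
give the route TARGET X = `TypeIAncientLiouville` (stmt-4050) — and hence the crux LL7 by the
anchor `TemperedStokesLiouville → X → LL7` machine-checked in W2.lean of triage r1-1. -/
theorem typeIAncientLiouville_of_energyTypeI
    (hK1 : ABClassOfTimeShift) (h1749 : NoTypeIAncientAB) (hcont : AEZeroContinuousIsZero) :
    Theses.SymmetryModuliCount.TypeIAncientLiouville := by
  intro C u hu t ht x
  -- shift by h := -t/2 > 0, so that (t, x) ↦ (t + h, x) = (t/2, x) stays in the open slab
  have hh : 0 < -t / 2 := by linarith
  have hA : InClassA C u := hu
  obtain ⟨p, G, hmeas, hmild, hsuit, hgrad, hI⟩ := hK1 C u hA (-t / 2) hh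
  -- if the shifted field were not a.e. zero it would contradict 1749
  by_cases hae : Function.uncurry (timeShift (-t / 2) u)
      =ᵐ[volume.restrict (Set.Iio (0 : ℝ) ×ˢ (Set.univ : Set ℝ³))] 0
  · -- continuity of u on the slab gives continuity of the shift on the slab
    have hcontu : ContinuousOn (Function.uncurry u) (Set.Iio 0 ×ˢ Set.univ) := hu.1.continuousOn
    have hcs : ContinuousOn (Function.uncurry (timeShift (-t / 2) u)) (Set.Iio 0 ×ˢ Set.univ) := by
      have hmap : Set.MapsTo (fun z : ℝ × ℝ³ => (z.1 - (-t / 2), z.2))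
          (Set.Iio 0 ×ˢ Set.univ) (Set.Iio 0 ×ˢ Set.univ) := by
        intro z hz
        simp only [Set.mem_prod, Set.mem_Iio, Set.mem_univ, and_true] at hz ⊢
        linarith
      have hφ : Continuous (fun z : ℝ × ℝ³ => (z.1 - (-t / 2), z.2)) := by fun_prop
      have := hcontu.comp hφ.continuousOn hmap
      refine this.congr ?_
      intro z _
      rfl
    have h0 := hcont _ hcs hae (t / 2) (by linarith) x
    -- timeShift (-t/2) u (t/2) x = u (t/2 - (-t/2)) x = u t x
    have : timeShift (-t / 2) u (t / 2) x = u t x := by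
      simp only [timeShift]
      congr 1
      ring
    rw [← this]
    exact h0
  · exact absurd ⟨timeShift (-t / 2) u, p, G, hmeas, hmild, hsuit, hgrad, hae, hI⟩ h1749

/-- CRUX K2 (`DiluteLiouville`): an element of `𝒜_C` whose far field is DILUTE — energy slope zero
at spatial infinity, measured in parabolic units from a fixed centre: for every `ε` there is `ρ₀`
with `∫_{B_R(0)}|u(t)|² ≤ ε R` whenever `R ≥ ρ₀ √(-t)` — vanishes. Anchor sub-cases: finite
similarity energy (next decl; known via `L^∞_t L³_x`), Hardy-bounded profiles (route HardyPointSink,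
crux 7980, along a sequence of radii). The residual sector of X after K2 is "energy slope > 0". -/
def DiluteLiouville : Prop :=
  ∀ (C : ℝ) (u : ℝ → ℝ³ → ℝ³), InClassA C u →
    (∀ ε : ℝ, 0 < ε → ∃ ρ₀ : ℝ, 0 < ρ₀ ∧ ∀ t < 0, ∀ R : ℝ, ρ₀ * Real.sqrt (-t) ≤ R →
        (∫ x in Metric.ball (0 : ℝ³) R, ‖u t x‖ ^ 2) ≤ ε * R) →
    ∀ t < 0, ∀ x, u t x = 0

/-- ANCHOR of K2 (provable modulo the in-tree ESS fact `ess_endpoint` / Dong–Du, size M–L): an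
element of `𝒜_C` with FINITE similarity energy obeying the self-similar law `‖u(t)‖₂² ≤ F √(-t)`
vanishes (`‖u(t)‖₃³ ≤ ‖u(t)‖_∞ ‖u(t)‖₂² ≤ C F`, so `u ∈ L^∞_t L³_x`; energy `→ 0` at `t = 0`). -/
def FiniteSimilarityEnergyLiouville : Prop :=
  ∀ (C : ℝ) (u : ℝ → ℝ³ → ℝ³), InClassA C u →
    (∃ F : ℝ, ∀ t < 0, Integrable (fun x => ‖u t x‖ ^ 2) volume ∧
        (∫ x, ‖u t x‖ ^ 2) ≤ F * Real.sqrt (-t)) →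
    ∀ t < 0, ∀ x, u t x = 0

/-! ## Card `mild-gauge-tangent-space` -/

/-- The GAUGE-FIXED tangent space: a tempered, smooth, divergence-free `v` solving the linearised
OSEEN (integral) equation around `u` between all `s < t < 0` — no pressure, no quotient. -/
def IsTemperedMild (u v : ℝ → ℝ³ → ℝ³) : Prop :=
  ContDiffOn ℝ (⊤ : ℕ∞) (Function.uncurry v) (Set.Iio 0 ×ˢ Set.univ) ∧
  (∃ K : ℝ, ∀ t < 0, ∀ x, ‖v t x‖ ≤ K / Real.sqrt (-t) + K * (1 + ‖x‖) / (-t)) ∧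
  (∀ t < 0, VectorCalculus.IsDivFree (v t)) ∧
  (∀ s t : ℝ, s < t → t < 0 → ∀ x, v t x = heatFlow (v s) (t - s) x -
      ∫ τ in Set.Ioo s t, ∫ y, (oseenKernel (t - τ) (x - y) (u τ y) (v τ y) +
        oseenKernel (t - τ) (x - y) (v τ y) (u τ y)))

/-- FIRST LEMMA of card 2 (provable, size M): the Oseen formulation kills the Galilean module. If a
modulated Galilean field `v_β = β'(t) - (β(t)·∇)u` (β smooth, `β, √(-t) β'` bounded so that `v_β` is
tempered given `|∇u| ≤ C₁/(-t)`) lies in the gauge-fixed tangent space of an element of `𝒜_C`,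
then `β' ≡ 0` on `t < 0` (constant-mode obstruction: large-ball averages of the Oseen identity give
`β'(t) = β'(s)` for all `s < t`, and temperedness at `-∞` forces the constant to vanish). -/
def GalileanExclusionMild : Prop :=
  ∀ (C C₁ : ℝ) (u : ℝ → ℝ³ → ℝ³), InClassA C u →
    (∀ t < 0, ∀ x, ‖fderiv ℝ (u t) x‖ ≤ C₁ / (-t)) →
    ∀ β : ℝ → ℝ³, ContDiff ℝ (⊤ : ℕ∞) β →
      (∃ M : ℝ, ∀ t < 0, ‖β t‖ ≤ M ∧ Real.sqrt (-t) * ‖deriv β t‖ ≤ M) →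
      IsTemperedMild u (fun t x => deriv β t - fderiv ℝ (u t) x (β t)) →
      ∀ t < 0, deriv β t = 0

/-- STRUCTURE THEOREM (provable, size M–L): the classical tempered tangent space of the route
(solutions `(v,q)` of the differential linearisation with the crux's growth bounds) splits as
gauge-fixed part ⊕ Galilean module: `v = w + (β' - (β·∇)u)` with `w` tempered-mild and `β` a
`C^∞` curve with `β/ (1+√(-t))`, `√(-t) β'` bounded. (So `LinearLiouvilleSeven` — dependence modulo
slice-constants in the classical space — fails at every nonzero `u` for Galilean reasons only, while
the count in the gauge-fixed space keeps its meaning.) -/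
def TangentSpaceSplitting : Prop :=
  ∀ (C C₁ : ℝ) (u : ℝ → ℝ³ → ℝ³), InClassA C u →
    (∀ t < 0, ∀ x, ‖fderiv ℝ (u t) x‖ ≤ C₁ / (-t)) →
    ∀ (v : ℝ → ℝ³ → ℝ³) (q : ℝ → ℝ³ → ℝ),
      (ContDiffOn ℝ (⊤ : ℕ∞) (Function.uncurry v) (Set.Iio 0 ×ˢ Set.univ) ∧
       ContDiffOn ℝ (⊤ : ℕ∞) (Function.uncurry q) (Set.Iio 0 ×ˢ Set.univ) ∧
       (∃ K : ℝ, ∀ t < 0, ∀ x, ‖v t x‖ ≤ K / Real.sqrt (-t) + K * (1 + ‖x‖) / (-t) ∧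
          |q t x| ≤ K / (-t) + K * (1 + ‖x‖) / Real.sqrt (-t) ^ 3) ∧
       (∀ t < 0, VectorCalculus.IsDivFree (v t)) ∧
       (∀ t < 0, ∀ x, timeDeriv v t x + convect (u t) (v t) x + convect (v t) (u t) x =
          Laplacian.laplacian (v t) x - gradient (q t) x)) →
      ∃ (w : ℝ → ℝ³ → ℝ³) (β : ℝ → ℝ³), IsTemperedMild u w ∧ ContDiff ℝ (⊤ : ℕ∞) β ∧
        (∃ M : ℝ, ∀ t < 0, ‖β t‖ ≤ M * (1 + Real.sqrt (-t)) ∧ Real.sqrt (-t) * ‖deriv β t‖ ≤ M) ∧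
        ∀ t < 0, ∀ x, v t x = w t x + (deriv β t - fderiv ℝ (u t) x (β t))

/-- The infinitesimal generator of `ξ = (c₀, a, σ, A) ∈ ℝ∂_t ⊕ sim(3)` on a field: time
translation, translation, scaling, rotation (the route's `L_ξ` plus `c₀ ∂_t`). -/
def generator8 (c₀ : ℝ) (a : ℝ³) (σ : ℝ) (A : ℝ³ →L[ℝ] ℝ³) (u : ℝ → ℝ³ → ℝ³) (t : ℝ) (x : ℝ³) : ℝ³ :=
  c₀ • timeDeriv u t x + fderiv ℝ (u t) x (a + σ • x + A x) + σ • u t x +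
    (2 * σ * t) • timeDeriv u t x - A (u t x)

/-- SUPPORT (provable, size M; KNSS-gauge bounds): around the time shift `u_h` (`h > 0`) of an
element of `𝒜_C`, all EIGHT Jacobi fields — the generators of time translation, translations,
scaling and rotations — lie in the gauge-fixed tangent space (differentiate `u = -B(u,u)` along
each one-parameter family; `∂_t u_h` is tempered with constant `≲ h^{-1/2}`). -/
def JacobiMild8 : Prop :=
  ∀ (C : ℝ) (u : ℝ → ℝ³ → ℝ³), InClassA C u → ∀ h : ℝ, 0 < h →
    ∀ (c₀ : ℝ) (a : ℝ³) (σ : ℝ) (A : ℝ³ →L[ℝ] ℝ³), (∀ x, ⟪A x, x⟫_ℝ = 0) →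
      IsTemperedMild (timeShift h u) (generator8 c₀ a σ A (timeShift h u))

/-- CRUX of card 2 (`LLmild8`, OPEN; the route's linear engine in its meaningful gauge): around an
element of `𝒜_C`, any eight members of the gauge-fixed tangent space are linearly dependent
(genuinely — no quotient). With `JacobiMild8`, `TimeSymmetricReduction` and the route crux
`SymmetricLiouville` (stmt-4053) it yields X, hence LL7. -/
def LLmild8 : Prop :=
  ∀ (C : ℝ) (u : ℝ → ℝ³ → ℝ³), InClassA C u →
    ∀ v : Fin 8 → ℝ → ℝ³ → ℝ³, (∀ i, IsTemperedMild u (v i)) →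
      ∃ c : Fin 8 → ℝ, c ≠ 0 ∧ ∀ t < 0, ∀ x, ∑ i, c i • v i t x = 0

/-- SUPPORT (provable GIVEN the route crux `SymmetricLiouville` = stmt-4053, size S–M): the
symmetric sub-cases with a TIME-TRANSLATION component add nothing new. If an element of `𝒜_C` is
annihilated by the generator of some `ξ = (c₀, a, σ, A)` with `c₀ ≠ 0`: `σ = 0` gives a travelling /
rigidly rotating wave, whose sup norm is constant in time and `≤ C/√(-t) → 0` (empty outright);
`σ ≠ 0` is (spiral) self-similarity about a time `T ≠ 0`: `T < 0` contradicts smoothness at `t = T`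
unless `u ≡ 0`; for `T > 0` the self-similar formula extends `u` to `(-∞, T)` and the time shift
by `T` is an element of some `𝒜_{C'}` with a PURE spiral-scaling symmetry — the rotation-free
case is Tsai 1998 Thm 1 (`q = ∞`, bounded profiles are constant, hence `0` in the Oseen gauge),
the rotating case is exactly 4053's sub-case (S_α); both are discharged by `SymmetricLiouville`. -/
def TimeSymmetricReduction : Prop :=
  Theses.SymmetryModuliCount.SymmetricLiouville →
  ∀ (C : ℝ) (u : ℝ → ℝ³ → ℝ³), InClassA C u →
    ∀ (c₀ : ℝ) (a : ℝ³) (σ : ℝ) (A : ℝ³ →L[ℝ] ℝ³), (∀ x, ⟪A x, x⟫_ℝ = 0) → c₀ ≠ 0 →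
      (∀ t < 0, ∀ x, generator8 c₀ a σ A u t x = 0) →
      ∀ t < 0, ∀ x, u t x = 0

end Summit.NavierStokesRegularity.NavierStokesRegularity.Cruxes.LinearLiouvilleSeven.Ideator2

end
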